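import Mathlib
import HarnessLib
import HarnessLib.Audit
import Summits.Langlands.Statement
import Summits.Langlands.Langlands.Theorems.ExtendedAdequacySplitProduct
import Literature.NumberTheory.GaloisRepresentations.AdequacyDegreeP
/-!
# SchurDefectSplit — decomp-langlands lens 5, generation 14: the hop BELOW the rev-2 residual CORE′ of route `ExtendedAdequacySplit`

TARGET.  CORE′ = `Summit.Langlands.Langlands.Theses.ExtendedAdequacySplit.CoreIrreducibleNonProductLifting` (stmt-Langlands-27082; kind residual,
rank 302; leaf tag IDEA-NEEDED): tail instances (ℓ < 2(n+1), ℓ ≤ n) whose residual image over `K(ζ_ℓ)` is absolutely irreducible with absolutely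
irreducible PERFECT CORE, admits no extended-adequate / quasi-adequate / adequate layer over any solvable extension, no solvable-descent shadow, and
is not a functorial product from GL₂ (rev 1 carve).  Rows of record (census I-L5g11–13): (3,9) projective image A₆ ≅ PSL₂(9) = Ω₃(9) (four rows;
GHT17 Thm 1.7(c), tree `OmegaThreeNine.not_isExtendedAdequate`), (4,2) the Steinberg module of SL₂(4) ≅ A₅ and S₅ over it (two rows); dark tail n ≥ 5.

THE IDEA (instrument g14, decided in session by finite computation; `compute/RESULTS.md` of the seat folder).  Thorne's Definition 2.20 = GHT 2017
adequacy asks (i) H¹(H,k) = 0, (ii) H¹(H, ad/Z) = 0, (iii) M_n(k) spanned by the semisimple elements of H.  For BOTH row types of record the image H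
satisfies (i), (iii) AND `H¹(H, ad) = 0` (Ω₃(9): dim Z¹ = B¹ = 8 on ad, span of 3′-elements = 9/9; A₅-Steinberg: H¹(ad) = 0, span 16/16), and fails
(ii) by exactly ONE class, which for Ω₃(9) restricts to ZERO on every cyclic subgroup and survives only on subgroups containing a Sylow-3 C₃ × C₃: it
is the image of the 3-part of the Schur multiplier, H¹(A₆, ad/Z) ≅ ker(H²(A₆,k) → H²(A₆,ad)) — the infinitesimal VALENTINER cover 3·A₆ (for A₅: the
2-part, 2·A₅ = SL₂(5)).  GHT 2017 §1 (arXiv p. 3): adequacy ⟺ Ext¹_H(V,V) = 0 ∧ weak adequacy whenever H²(H,k) = 0; p. 24: for PSL₂(9) in dimension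
3, Ext¹(V,V) = 0 and inadequacy comes only from H²(A₆,k) ≠ 0.  And the ONE place where Thorne 2017 visibly consumes Definition 2.20 — Prop. 2.21,
killing dual Selmer with F ∋ ζ_p — uses `H¹(Gal(K/F), ad ρ̄) = 0` (cohomology of the PROJECTIVE image with coefficients in ad, NOT ad/Z; Math. Z. 285
(2017) p. 25 of the CC-BY text), `ρ̄(G_{F_N}) = ρ̄(G_F)` (⟸ (i)) and the eigen-condition (⟺ (iii)).  So the rows of record are «LINEARLY adequate,
projectively inadequate»: the defect CORE′ carries at its rows of record is a pure Schur-multiplier class that the Taylor–Wiles–Thorne argument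
never meets.  (Negative instrument result, same computation: Khare–Thorne auxiliary Steinberg places (Amer. J. Math. 139, arXiv:1503.03796 §1, §8)
have NO TEETH on the A₆ rows — the class is invisible at every place unramified in ρ̄ — and are not needed either.)

THE NODE (one excluded middle, exact; R1 by construction — the dial quantifies a layer above the perfect core, like g13's SXADQ).
* dial  LIN(ρ) `SolvablyLinAdequateImage ρ`: some absolutely irreducible layer `J`, perfect core ≤ J ≤ image of `ρ̄|K(ζ_ℓ)`, is LINEARLY ADEQUATE
  (`IsLinearlyAdequate J`: Hom(J,k) = 0 ∧ H¹(J, ad) = 0 ∧ semisimpleSpan J = ⊤ — GHT (i), (iii) and Ext¹ = 0 in place of (ii)).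
* SCH  `SchurDefectLayerLifting`   := CORE′ ∧ LIN   — crux (rank 2).  ALL rows of record of CORE′ lie here (instrument g14).  Engine claim T⁺ (UNCERTIFIED
  print reading, the crux's why-might-fail): Thorne 2017 Thm 5.1 holds with Def. 2.20 weakened to linear adequacy; in its frame (F imaginary CM, ρ
  polarized, minimal type, residually automorphic) plus the lineage's solvable base change / descent items, SCH's CM-sector follows.
* LDF  `LinearDefectLifting`       := CORE′ ∧ ¬LIN  — DECLARED RESIDUAL (rank 3): every layer above the core has Ext¹ ≠ 0 or fails semisimple span.
  Rows of record: NONE in the computed ranges n ≤ 4; in print the diagonal boxes n = ℓ = p ≥ 5 hold exactly one row type, projective PSL₂(p) on the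
  Steinberg module L(p−1) (GHT17 Thm 1.7(c) + p. 24(a): H¹ = H² = Ext¹ = 0, NOT weakly adequate) — the opposite defect.  DARK (no engine).
* layer 2 under LDF (glued split, glue PROVED here: `ldf_of_carve`):  GHT `DegreePAdequacyClassification` := the tree NAMED FACT
  `ght2017_adequate_or_index_p_or_psl29` BY NAME (GHT17 Thm 1.7; literature-prover discharge in progress: `AdequacyDegreeP.lean` + siblings) ·
  VAL `ValentinerBoxLinearAdequacy` := GHT fact → every CORE-irreducible instance with (n, ℓ) = (3, 3) satisfies LIN (print-complete: Thm 1.7(c) ⇒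
  projective image A₆ ⇒ H = Z′ × A₆-copy ⇒ linearly adequate by the g14 computation + "dimensions do not change under extension of scalars", GHT p. 4)
  · LDF′ `LinearDefectOffValentinerLifting` := LDF ∧ (n, ℓ) ≠ (3, 3): the residual with its FIRST BOX PROVABLY VACATED — minimal open layer n = 4.
KERNEL: CORE′ ⟺ SCH ∧ LDF (`coreN_iff_cells`, one `Classical.em`); LDF ⟸ GHT ∧ VAL ∧ LDF′ (`ldf_of_carve`) and LDF ⟹ LDF′; `closes : SCH → LDF → CORE′`
concludes the HOST CRUX BY NAME (child route `--refines route-Langlands-ExtendedAdequacySplit:CoreIrreducibleNonProductLifting`); `closes_core` reaches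
the rev-0 residual CORE with CPR, `closes_root` reaches `_root_.Langlands` through the landed `ExtAdequacy.Product.closes_root` (18 binders).
NECESSITY (`Cert`): SCH, LDF ⟸ CORE′ ⟸ `_root_.Langlands` — both cells WEAKER, never costume-by-strength; 0 sorry, 0 EQUIV placeholders.

Sources: [corpus:paper:doi-10-1007-s00209-016-1681-2 p24 Def 2.20, p25 Prop 2.21 (Thorne, Math. Z. 285 (2017) 1–38)] · [corpus:paper:arxiv-1405.0043
p3, p4, p24 (Guralnick–Herzig–Tiep, JEMS 19 (2017) Thm 1.7, §1)] · [corpus:paper:arxiv-1503.03796 p4, p18–20 (Khare–Thorne, Amer. J. Math. 139 (2017))]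
· tree: `Literature.NumberTheory.GaloisRepresentations.Subgroup.IsExtendedAdequate` / `.adRep` / `.semisimpleSpan`, `OmegaThreeNine.not_isExtendedAdequate`,
`ght2017_adequate_or_index_p_or_psl29` (+ `_of_isAlgClosed`, `_of_primitive`, `_of_socle_odd`), `Theorems.CoreAdequacy.ExtAdequacy.Product.*` (p795319).
-/

set_option linter.dupNamespace false
namespace Summit.Langlands.Langlands.Theorems.CoreAdequacy.ExtAdequacy.Schur

open Filter
open scoped MatrixGroups
open Literature.NumberTheory.GaloisRepresentations
open Summit.Langlands.Langlands.Theses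
open Summit.Langlands.Langlands.Theorems.CoreAdequacy.ExtAdequacy.Product (SolvablyFunctorialProduct CoreIrreducibleProductLifting)

/-! ## §1 THE DIAL — linear adequacy (GHT (i), (iii) and `H¹(H, ad) = 0` in place of `H¹(H, ad/Z) = 0`) -/

section Dial
variable {k : Type} [Field k] {n : ℕ}

/-- **Linear adequacy** of `H ≤ GL_n(k)`: (i) `Hom(H, k) = 0`; (ii-lin) `H¹(H, ad) = 0` — every `1`-cocycle of the conjugation representation on
`M_n(k)` (`Subgroup.adRep`, coefficients in ad, NOT ad/Z) is a coboundary, i.e. `Ext¹_{k[H]}(V, V) = 0`; (iii) `M_n(k)` is spanned by the semisimple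
elements of `H`.  Extended adequacy (`Subgroup.IsExtendedAdequate`, GHT17 / Thorne Def 2.20) implies it (long exact sequence of `0 → k → ad → ad/Z → 0`
with (i)); the converse holds when `H²(H, k) = 0` (GHT17 arXiv p. 3) and FAILS for `Ω₃(9) ≅ A₆ < GL₃(𝔽₉)` (instrument g14: linearly adequate, not
extended-adequate — the Valentiner class). -/
def IsLinearlyAdequate (H : Subgroup (GL (Fin n) k)) : Prop :=
  (∀ f : Additive H →+ k, f = 0) ∧
    groupCohomology.cocycles₁ (Rep.of (Subgroup.adRep H)) ≤ groupCohomology.coboundaries₁ (Rep.of (Subgroup.adRep H)) ∧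
      Subgroup.semisimpleSpan H = ⊤

/-- Unfolding lemma. -/
theorem isLinearlyAdequate_iff (H : Subgroup (GL (Fin n) k)) : IsLinearlyAdequate H ↔
    (∀ f : Additive H →+ k, f = 0) ∧
      groupCohomology.cocycles₁ (Rep.of (Subgroup.adRep H)) ≤ groupCohomology.coboundaries₁ (Rep.of (Subgroup.adRep H)) ∧
        Subgroup.semisimpleSpan H = ⊤ := Iff.rfl

/-- Linear adequacy contains GHT clauses (i) and (iii) verbatim. -/
theorem IsLinearlyAdequate.addMonoidHom_eq_zero {H : Subgroup (GL (Fin n) k)} (h : IsLinearlyAdequate H) (f : Additive H →+ k) : f = 0 := h.1 f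

/-- clause (iii) of linear adequacy: the semisimple (ℓ′-order) elements span `M_n(k)`. -/
theorem IsLinearlyAdequate.semisimpleSpan_eq_top {H : Subgroup (GL (Fin n) k)} (h : IsLinearlyAdequate H) : Subgroup.semisimpleSpan H = ⊤ := h.2.2

/-- **Group-level dial**: a linearly adequate absolutely irreducible LAYER above the perfect core (mirror of g13's `ExtAdequateBetween`). -/
def LinAdequateBetween (I : Subgroup (GL (Fin n) k)) : Prop :=
  ∃ J : Subgroup (GL (Fin n) k), LieDefect.AboveCore I J ∧ J ≤ I ∧ IsAbsIrreducible J.subtype ∧ IsLinearlyAdequate J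

/-- A linearly adequate absolutely irreducible `I` is its own layer. -/
theorem linAdequateBetween_of_self {I : Subgroup (GL (Fin n) k)} (hirr : IsAbsIrreducible I.subtype) (h : IsLinearlyAdequate I) : LinAdequateBetween I :=
  ⟨I, fun _ hQ _ => hQ, le_rfl, hirr, h⟩

/-- **ORBIT LEMMA (up).**  A normal `I' ◁ I` with solvable quotient has the same perfect core, so a layer for `I'` is a layer for `I`: the dial is
MONOTONE up the solvable orbit (hence its negation is inherited DOWN — R1 for the residual by construction). -/
theorem LinAdequateBetween.of_normal_of_isSolvable_quotient {I I' : Subgroup (GL (Fin n) k)} (hle : I' ≤ I) [(I'.subgroupOf I).Normal]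
    (hsolv : IsSolvable (I ⧸ I'.subgroupOf I)) (h : LinAdequateBetween I') : LinAdequateBetween I := by
  obtain ⟨J, hPJ, hJI, hirr, hx⟩ := h
  exact ⟨J, (LieDefect.aboveCore_iff_of_normal_of_isSolvable_quotient hle hsolv).1 hPJ, hJI.trans hle, hirr, hx⟩

end Dial

/-- **LIN — the field-level dial** `SolvablyLinAdequateImage ρ`: some absolutely irreducible reduction `τ` of `ρ|K(ζ_ℓ)` has a linearly adequate
absolutely irreducible layer above its perfect core. -/
def SolvablyLinAdequateImage {K : Type} [Field K] [NumberField K] {ℓ : ℕ} [Fact ℓ.Prime] {n : ℕ} (ρ : FramedGaloisRep K (PadicAlgCl ℓ) n) : Prop :=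
  ∃ τ : Field.absoluteGaloisGroup (CyclotomicField ℓ K) →* GL (Fin n) (padicAlgClResidueField ℓ),
    (ρ.restrictField (CyclotomicField ℓ K)).IsReductionOf (RingHom.id _) τ ∧ IsAbsIrreducible τ ∧
      ∃ J : Subgroup (GL (Fin n) (padicAlgClResidueField ℓ)), LieDefect.AboveCore τ.range J ∧ J ≤ τ.range ∧ IsAbsIrreducible J.subtype ∧
        IsLinearlyAdequate J

/-- The field-level dial is the group-level predicate on the image (definitional). -/
theorem solvablyLinAdequateImage_iff {K : Type} [Field K] [NumberField K] {ℓ : ℕ} [Fact ℓ.Prime] {n : ℕ} (ρ : FramedGaloisRep K (PadicAlgCl ℓ) n) :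
    SolvablyLinAdequateImage ρ ↔ ∃ τ : Field.absoluteGaloisGroup (CyclotomicField ℓ K) →* GL (Fin n) (padicAlgClResidueField ℓ),
      (ρ.restrictField (CyclotomicField ℓ K)).IsReductionOf (RingHom.id _) τ ∧ IsAbsIrreducible τ ∧ LinAdequateBetween τ.range := Iff.rfl

/-- LIN ⟹ CycIrr. -/
theorem cycIrr_of_solvablyLinAdequateImage {K : Type} [Field K] [NumberField K] {ℓ : ℕ} [Fact ℓ.Prime] {n : ℕ} (ρ : FramedGaloisRep K (PadicAlgCl ℓ) n)
    (h : SolvablyLinAdequateImage ρ) : CycIrr ρ := by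
  obtain ⟨τ, hτ, hirr, _⟩ := h
  exact ⟨τ, hτ, hirr⟩

/-- Excluded middle on LIN. -/
theorem lin_dichotomy {K : Type} [Field K] [NumberField K] {ℓ : ℕ} [Fact ℓ.Prime] {n : ℕ} (ρ : FramedGaloisRep K (PadicAlgCl ℓ) n) :
    SolvablyLinAdequateImage ρ ∨ ¬ SolvablyLinAdequateImage ρ := Classical.em _

/-! ## §2 THE CELLS (structured twins; the route one-liners inline LIN — bridges `Iff.rfl` in the mirror namespace below) -/

/-- **SCH — SCHUR-DEFECT LAYER LIFTING** (CORE′ ∧ LIN) — crux rank 2.  The instance has a linearly adequate absolutely irreducible layer above its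
perfect core, yet (CORE′) no extended-adequate one: the Lie defect is a pure Schur-multiplier class.  ALL rows of record of CORE′: (3,9) A₆ × 4,
(4,2) A₅/S₅-Steinberg × 2 (instrument g14).  Engine claim T⁺ (uncertified print reading of Thorne 2017 Prop 2.21): Thm 5.1 with linear adequacy. -/
def SchurDefectLayerLifting : Prop :=
  ∀ (K : Type) [Field K] [NumberField K] (n : ℕ) (hcpt : Literature.NumberTheory.Automorphic.isCompact_glFiniteIntegralLevel n K), 0 < n →
    LiftBelow n → ∀ (ℓ : ℕ) [Fact ℓ.Prime] (ι : PadicAlgCl ℓ ≃+* ℂ) (ρ : FramedGaloisRep K (PadicAlgCl ℓ) n),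
      ℓ < 2 * (n + 1) → CycIrr ρ → ¬ AdequateCyclotomicImage ρ → ¬ SolvablyAdequateImage ρ →
        ¬ LieDefect.SolvableDescentShadow ρ → ¬ LieDefect.SolvablyQuasiAdequateImage ρ → ℓ ≤ n → ¬ SolvablyExtAdequateImage ρ → CoreIrreducibleImage ρ →
          ¬ SolvablyFunctorialProduct ρ → SolvablyLinAdequateImage ρ →
            ¬ Theorems.BrightMate.SolvablyReducible ρ → ¬ Theorems.BrightMate.SolvablyMated ι ρ → LiftTail K n hcpt ℓ ι ρ

/-- **LDF — LINEAR-DEFECT LIFTING** (CORE′ ∧ ¬LIN) — DECLARED RESIDUAL, rank 3.  Every absolutely irreducible layer above the perfect core has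
`Ext¹ ≠ 0` or fails semisimple span.  Rows of record: none for n ≤ 4 in the computed ranges; in print on the diagonal n = ℓ = p ≥ 5 exactly the
projective-PSL₂(p) Steinberg rows (GHT17 Thm 1.7(c), p. 24(a)).  DARK: no lifting theorem in print. -/
def LinearDefectLifting : Prop :=
  ∀ (K : Type) [Field K] [NumberField K] (n : ℕ) (hcpt : Literature.NumberTheory.Automorphic.isCompact_glFiniteIntegralLevel n K), 0 < n →
    LiftBelow n → ∀ (ℓ : ℕ) [Fact ℓ.Prime] (ι : PadicAlgCl ℓ ≃+* ℂ) (ρ : FramedGaloisRep K (PadicAlgCl ℓ) n),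
      ℓ < 2 * (n + 1) → CycIrr ρ → ¬ AdequateCyclotomicImage ρ → ¬ SolvablyAdequateImage ρ →
        ¬ LieDefect.SolvableDescentShadow ρ → ¬ LieDefect.SolvablyQuasiAdequateImage ρ → ℓ ≤ n → ¬ SolvablyExtAdequateImage ρ → CoreIrreducibleImage ρ →
          ¬ SolvablyFunctorialProduct ρ → ¬ SolvablyLinAdequateImage ρ →
            ¬ Theorems.BrightMate.SolvablyReducible ρ → ¬ Theorems.BrightMate.SolvablyMated ι ρ → LiftTail K n hcpt ℓ ι ρ

/-- **LDF′ — LINEAR-DEFECT LIFTING OFF THE VALENTINER BOX** (LDF ∧ (n, ℓ) ≠ (3, 3)) — layer-2 child of LDF: the residual with its first box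
vacated (GHT17 Thm 1.7(c) + instrument g14 put every (3,3) CORE-irreducible instance in LIN).  Minimal open layer: n = 4, ℓ ∈ {2, 3}. -/
def LinearDefectOffValentinerLifting : Prop :=
  ∀ (K : Type) [Field K] [NumberField K] (n : ℕ) (hcpt : Literature.NumberTheory.Automorphic.isCompact_glFiniteIntegralLevel n K), 0 < n →
    LiftBelow n → ∀ (ℓ : ℕ) [Fact ℓ.Prime] (ι : PadicAlgCl ℓ ≃+* ℂ) (ρ : FramedGaloisRep K (PadicAlgCl ℓ) n),
      ℓ < 2 * (n + 1) → CycIrr ρ → ¬ AdequateCyclotomicImage ρ → ¬ SolvablyAdequateImage ρ →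
        ¬ LieDefect.SolvableDescentShadow ρ → ¬ LieDefect.SolvablyQuasiAdequateImage ρ → ℓ ≤ n → ¬ SolvablyExtAdequateImage ρ → CoreIrreducibleImage ρ →
          ¬ SolvablyFunctorialProduct ρ → ¬ SolvablyLinAdequateImage ρ → ¬ (n = 3 ∧ ℓ = 3) →
            ¬ Theorems.BrightMate.SolvablyReducible ρ → ¬ Theorems.BrightMate.SolvablyMated ι ρ → LiftTail K n hcpt ℓ ι ρ

/-- **GHT — DEGREE-p ADEQUACY CLASSIFICATION** — layer-2 support := the tree NAMED FACT `ght2017_adequate_or_index_p_or_psl29` (GHT17 Thm 1.7) BY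
NAME, at universe levels (0, 0); discharged when the literature side lands `…_holds` (reductions `_of_isAlgClosed`, `_of_primitive`, `_of_socle_odd`
already in `AdequacyDegreeP.lean`). -/
def DegreePAdequacyClassification : Prop :=
  Literature.NumberTheory.GaloisRepresentations.ght2017_adequate_or_index_p_or_psl29.{0, 0}

/-- **VAL — THE VALENTINER BOX IS LINEARLY ADEQUATE** — layer-2 support (print-complete modulo the GHT fact it takes as antecedent): a
CORE-irreducible instance with (n, ℓ) = (3, 3) — typed directly over `PadicAlgCl 3` and `Fin 3`, no (n, ℓ) binders — has a linearly adequate layer.  Thm 1.7 at dim = char = 3: (a) extended adequate ⇒ linearly adequate;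
(b) abelian normal subgroup of index 3 ⇒ image solvable ⇒ perfect core trivial, not absolutely irreducible — excluded by CORE-irreducibility;
(c) projective image A₆ ⇒ H = Z′ · Ω₃(9)-conjugate (2·A₆ = SL₂(9) has no faithful irreducible 3-dimensional module in characteristic 3) ⇒
Hom(H,k) = 0, H¹(H, ad) = H¹(A₆, ad) = 0 and span = M₃ (instrument g14 over 𝔽₉; extension of scalars, GHT p. 4). -/
def ValentinerBoxLinearAdequacy : Prop :=
  DegreePAdequacyClassification → ∀ (K : Type) [Field K] [NumberField K] [Fact (Nat.Prime 3)] (ρ : FramedGaloisRep K (PadicAlgCl 3) 3),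
    CoreIrreducibleImage ρ → SolvablyLinAdequateImage ρ

/-! ## §3 KERNEL — CORE′ ⟺ SCH ∧ LDF (one excluded middle on LIN); LDF ⟸ GHT ∧ VAL ∧ LDF′ (layer-2 glue); bridges to the ROUTE decl -/

/-- The route's rev-2 residual CORE′ (Theses decl, stmt-Langlands-27082) is the landed structured twin (definitional). -/
theorem route_coreN_iff : ExtendedAdequacySplit.CoreIrreducibleNonProductLifting ↔ Product.CoreIrreducibleNonProductLifting := Iff.rfl

/-- The route's rev-2 support CPR (stmt-Langlands-27081) is the landed structured twin (definitional). -/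
theorem route_cpr_iff : ExtendedAdequacySplit.CoreIrreducibleProductLifting ↔ Product.CoreIrreducibleProductLifting := Iff.rfl

/-- **CORE′ ⟺ SCH ∧ LDF** on the structured twins — exact, one `Classical.em`. -/
theorem coreN_iff_cells : Product.CoreIrreducibleNonProductLifting ↔ SchurDefectLayerLifting ∧ LinearDefectLifting :=
  ⟨fun h => ⟨fun K _ _ n hcpt hn ih ℓ _ ι ρ hlt hc hA hS hDs hQ hle hx hco hnp _ => h K n hcpt hn ih ℓ ι ρ hlt hc hA hS hDs hQ hle hx hco hnp,
      fun K _ _ n hcpt hn ih ℓ _ ι ρ hlt hc hA hS hDs hQ hle hx hco hnp _ => h K n hcpt hn ih ℓ ι ρ hlt hc hA hS hDs hQ hle hx hco hnp⟩,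
    fun h K _ _ n hcpt hn ih ℓ _ ι ρ hlt hc hA hS hDs hQ hle hx hco hnp => by
      rcases lin_dichotomy ρ with hl | hl
      · exact h.1 K n hcpt hn ih ℓ ι ρ hlt hc hA hS hDs hQ hle hx hco hnp hl
      · exact h.2 K n hcpt hn ih ℓ ι ρ hlt hc hA hS hDs hQ hle hx hco hnp hl⟩

/-- The ROUTE's CORE′ ⟺ SCH ∧ LDF. -/
theorem coreN_route_iff_cells : ExtendedAdequacySplit.CoreIrreducibleNonProductLifting ↔ SchurDefectLayerLifting ∧ LinearDefectLifting :=
  route_coreN_iff.trans coreN_iff_cells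

/-- LDF ⟹ LDF′ (the child forgets the carve). -/
theorem ldfOff_of_ldf (h : LinearDefectLifting) : LinearDefectOffValentinerLifting :=
  fun K _ _ n hcpt hn ih ℓ _ ι ρ hlt hc hA hS hDs hQ hle hx hco hnp hl _ => h K n hcpt hn ih ℓ ι ρ hlt hc hA hS hDs hQ hle hx hco hnp hl

/-- **Layer-2 glue** LDF ⟸ GHT ∧ VAL ∧ LDF′: on the Valentiner box VAL contradicts ¬LIN; elsewhere LDF′ applies. -/
theorem ldf_of_carve (hG : DegreePAdequacyClassification) (hV : ValentinerBoxLinearAdequacy) (hL : LinearDefectOffValentinerLifting) : LinearDefectLifting := by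
  intro K _ _ n hcpt hn ih ℓ _ ι ρ hlt hc hA hS hDs hQ hle hx hco hnp hl
  by_cases h33 : n = 3 ∧ ℓ = 3
  · obtain ⟨rfl, rfl⟩ := h33
    exact absurd (hV hG K ρ hco) hl
  · exact hL K n hcpt hn ih ℓ ι ρ hlt hc hA hS hDs hQ hle hx hco hnp hl h33

/-- Modulo GHT ∧ VAL the split of LDF is exact. -/
theorem ldf_iff_ldfOff (hG : DegreePAdequacyClassification) (hV : ValentinerBoxLinearAdequacy) : LinearDefectLifting ↔ LinearDefectOffValentinerLifting :=
  ⟨ldfOff_of_ldf, ldf_of_carve hG hV⟩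

/-! ## §4 DECIDING THEOREMS — the child route's `closes` concludes the HOST CRUX BY NAME; CORE and `_root_.Langlands` by the landed glue -/

/-- **`closes`** — SCH → LDF → CORE′ (the host crux `ExtendedAdequacySplit.CoreIrreducibleNonProductLifting`, BY NAME). -/
theorem closes (hS : SchurDefectLayerLifting) (hL : LinearDefectLifting) : ExtendedAdequacySplit.CoreIrreducibleNonProductLifting :=
  coreN_route_iff_cells.2 ⟨hS, hL⟩

/-- Layer-2 form: SCH → GHT → VAL → LDF′ → CORE′. -/
theorem closes_carve (hS : SchurDefectLayerLifting) (hG : DegreePAdequacyClassification) (hV : ValentinerBoxLinearAdequacy)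
    (hL : LinearDefectOffValentinerLifting) : ExtendedAdequacySplit.CoreIrreducibleNonProductLifting :=
  closes hS (ldf_of_carve hG hV hL)

/-- CPR → SCH → LDF → CORE (the rev-0 residual `ExtendedAdequacySplit.CoreIrreducibleInadequateLifting`, via the landed `core_route_of_product_cells`). -/
theorem closes_core (hP : ExtendedAdequacySplit.CoreIrreducibleProductLifting) (hS : SchurDefectLayerLifting) (hL : LinearDefectLifting) :
    ExtendedAdequacySplit.CoreIrreducibleInadequateLifting :=
  Product.core_route_of_product_cells (route_cpr_iff.1 hP) (route_coreN_iff.1 (closes hS hL))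

/-- ROOT form — the landed `Product.closes_root` with CORE′ replaced by SCH ∧ LDF: 18 binders → `_root_.Langlands`. -/
theorem closes_root (hX : ExtendedAdequacySplit.ExtendedAdequateLayerLifting) (hS : SchurDefectLayerLifting) (hL : LinearDefectLifting)
    (hH : ExtendedAdequacySplit.GenericPrimeDegenerateLifting)
    (hOW : LieDefectSplit.OdlyzkoWorldAutomorphy) (hRES : LieDefectSplit.TransOdlyzkoAutomorphy) (hW : LieDefectSplit.SatakeAvatarExistence) (hDown : LieDefectSplit.CliffordSolvableDescent)
    (hPO : OdlyzkoWorldSplit.CyclotomicReducibleOrdinaryLifting) (hR2 : OdlyzkoWorldSplit.CyclotomicReducibleNonOrdinaryRankTwoLifting) (hR3 : OdlyzkoWorldSplit.CyclotomicReducibleNonOrdinaryHigherRankLifting)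
    (hTn : ExtendedAdequacySplit.CoreReducibleTransport) (hTp : Product.ProductDescentTransport)
    (hLie : LieDefectSplit.LieObstructedLifting) (hTd : LieDefectSplit.SolvableDescentTransport) (hUp : LieDefectSplit.SolvableAscentConstituent)
    (h₁ : LieDefectSplit.AdequateImageLifting) (hT : LieDefectSplit.SolvableAdequacyTransport) (hF0 : LieDefectSplit.NoAdequateLayerFrame) : _root_.Langlands :=
  Product.closes_root hX (coreN_iff_cells.2 ⟨hS, hL⟩) hH hOW hRES hW hDown hPO hR2 hR3 hTn hTp hLie hTd hUp h₁ hT hF0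

/-! ## §5 NECESSITY — the cells are implied by CORE′ (hence by CORE, DEG, `_root_.Langlands`): WEAKER, never costume-by-strength -/

namespace Cert

/-- NECESSITY: the host crux CORE′ (route decl) implies SCH (drop the hypothesis LIN). -/
theorem sch_of_coreN (h : ExtendedAdequacySplit.CoreIrreducibleNonProductLifting) : SchurDefectLayerLifting := (coreN_route_iff_cells.1 h).1

/-- NECESSITY: CORE′ implies LDF (drop ¬LIN). -/
theorem ldf_of_coreN (h : ExtendedAdequacySplit.CoreIrreducibleNonProductLifting) : LinearDefectLifting := (coreN_route_iff_cells.1 h).2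

/-- NECESSITY: CORE′ implies LDF′. -/
theorem ldfOff_of_coreN (h : ExtendedAdequacySplit.CoreIrreducibleNonProductLifting) : LinearDefectOffValentinerLifting := ldfOff_of_ldf (ldf_of_coreN h)

/-- NECESSITY from the summit: `Langlands → SCH` (through the landed `Product.Cert.coreN_of_langlands`). -/
theorem sch_of_langlands (hS : _root_.Langlands) : SchurDefectLayerLifting :=
  (coreN_iff_cells.1 (Product.Cert.coreN_of_langlands hS)).1

/-- NECESSITY from the summit: `Langlands → LDF`. -/
theorem ldf_of_langlands (hS : _root_.Langlands) : LinearDefectLifting :=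
  (coreN_iff_cells.1 (Product.Cert.coreN_of_langlands hS)).2

/-- NECESSITY from CORE 26842 (the host route's parent crux): `CORE → SCH`. -/
theorem sch_of_core (h : ExtendedAdequacySplit.CoreIrreducibleInadequateLifting) : SchurDefectLayerLifting :=
  (coreN_iff_cells.1 (Product.Cert.coreN_of_core h)).1

/-- NECESSITY from CORE 26842: `CORE → LDF`. -/
theorem ldf_of_core (h : ExtendedAdequacySplit.CoreIrreducibleInadequateLifting) : LinearDefectLifting :=
  (coreN_iff_cells.1 (Product.Cert.coreN_of_core h)).2

end Cert

end Summit.Langlands.Langlands.Theorems.CoreAdequacy.ExtAdequacy.Schur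

/-! ## §6 MIRROR — the child route's items as ONE-LINERS (LIN inlined, verbatim the route.json statements) + `closes` over them -/

namespace Summit.Langlands.Langlands.Theorems.SchurDefectInline

open Summit.Langlands.Langlands.Theorems.CoreAdequacy

/-- SCH one-liner (route item `SchurDefectLayerLifting`). -/
def SchurDefectLayerLifting : Prop :=
    ∀ (K : Type) [Field K] [NumberField K] (n : ℕ) (hcpt : Literature.NumberTheory.Automorphic.isCompact_glFiniteIntegralLevel n K), 0 < n → Summit.Langlands.Langlands.Theorems.CoreAdequacy.LiftBelow n → ∀ (ℓ : ℕ) [Fact ℓ.Prime] (ι : PadicAlgCl ℓ ≃+* ℂ) (ρ : Literature.NumberTheory.GaloisRepresentations.FramedGaloisRep K (PadicAlgCl ℓ) n), ℓ < 2 * (n + 1) → Summit.Langlands.Langlands.Theorems.CoreAdequacy.CycIrr ρ → ¬ Summit.Langlands.Langlands.Theorems.CoreAdequacy.AdequateCyclotomicImage ρ → ¬ Summit.Langlands.Langlands.Theorems.CoreAdequacy.SolvablyAdequateImage ρ → ¬ Summit.Langlands.Langlands.Theorems.CoreAdequacy.LieDefect.SolvableDescentShadow ρ → ¬ Summit.Langlands.Langlands.Theorems.CoreAdequacy.LieDefect.SolvablyQuasiAdequateImage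 ρ → ℓ ≤ n → ¬ (∃ τ : Field.absoluteGaloisGroup (CyclotomicField ℓ K) →* Matrix.GeneralLinearGroup (Fin n) (Literature.NumberTheory.GaloisRepresentations.padicAlgClResidueField ℓ), (ρ.restrictField (CyclotomicField ℓ K)).IsReductionOf (RingHom.id (Literature.NumberTheory.GaloisRepresentations.padicAlgClResidueField ℓ)) τ ∧ Literature.NumberTheory.GaloisRepresentations.IsAbsIrreducible τ ∧ ∃ J : Subgroup (Matrix.GeneralLinearGroup (Fin n) (Literature.NumberTheory.GaloisRepresentations.padicAlgClResidueField ℓ)), Summit.Langlands.Langlands.Theorems.CoreAdequacy.LieDefect.AboveCore τ.range J ∧ J ≤ τ.range ∧ Literature.NumberTheory.GaloisRepresentations.IsAbsIrreducible J.subtype ∧ Literature.NumberTheory.GaloisRepresentations.Subgroup.IsExtendedAdequate J) → (∃ τ : Field.absoluteGaloisGroup (CyclotomicField ℓ K) →* Matrix.GeneralLinearGroup (Fin n) (Literature.NumberTheory.GaloisRepresentations.padicAlgClResidueField ℓ), (ρ.restrictField (CyclotomicField ℓ K)).IsReductionOf (RingHom.id (Literature.NumberTheory.GaloisRepresentations.padicAlgClResidueField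 ℓ)) τ ∧ Literature.NumberTheory.GaloisRepresentations.IsAbsIrreducible τ ∧ Literature.NumberTheory.GaloisRepresentations.IsAbsIrreducible (Summit.Langlands.Langlands.Theorems.CoreAdequacy.perfectCore τ.range).subtype) → ¬ (∃ (E : Type) (_ : Field E) (_ : NumberField E) (_ : Algebra K E), IsGalois K E ∧ IsSolvable (E ≃ₐ[K] E) ∧ ((∃ (σ : Literature.NumberTheory.GaloisRepresentations.FramedGaloisRep E (PadicAlgCl ℓ) 2) (χ : Literature.NumberTheory.GaloisRepresentations.FramedGaloisRep E (PadicAlgCl ℓ) 1), σ.toGaloisRep.IsIrreducible ∧ Summit.Langlands.Langlands.Theorems.CoreAdequacy.LieDefect.Geometric σ ∧ Summit.Langlands.Langlands.Theorems.CoreAdequacy.LieDefect.Geometric χ ∧ ∀ g : Field.absoluteGaloisGroup E, 2 * Literature.NumberTheory.GaloisRepresentations.FramedRep.trace (ρ.restrictField E) g = Literature.NumberTheory.GaloisRepresentations.FramedRep.trace χ g * (Literature.NumberTheory.GaloisRepresentations.FramedRep.trace σ g ^ 2 + Literature.NumberTheory.GaloisRepresentations.FramedRep.trace σ (g * g)))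 ∨ (∃ σ₁ σ₂ : Literature.NumberTheory.GaloisRepresentations.FramedGaloisRep E (PadicAlgCl ℓ) 2, σ₁.toGaloisRep.IsIrreducible ∧ σ₂.toGaloisRep.IsIrreducible ∧ Summit.Langlands.Langlands.Theorems.CoreAdequacy.LieDefect.Geometric σ₁ ∧ Summit.Langlands.Langlands.Theorems.CoreAdequacy.LieDefect.Geometric σ₂ ∧ ∀ g : Field.absoluteGaloisGroup E, Literature.NumberTheory.GaloisRepresentations.FramedRep.trace (ρ.restrictField E) g = Literature.NumberTheory.GaloisRepresentations.FramedRep.trace σ₁ g * Literature.NumberTheory.GaloisRepresentations.FramedRep.trace σ₂ g))) → (∃ τ : Field.absoluteGaloisGroup (CyclotomicField ℓ K) →* Matrix.GeneralLinearGroup (Fin n) (Literature.NumberTheory.GaloisRepresentations.padicAlgClResidueField ℓ), (ρ.restrictField (CyclotomicField ℓ K)).IsReductionOf (RingHom.id (Literature.NumberTheory.GaloisRepresentations.padicAlgClResidueField ℓ)) τ ∧ Literature.NumberTheory.GaloisRepresentations.IsAbsIrreducible τ ∧ ∃ J : Subgroup (Matrix.GeneralLinearGroup (Fin n) (Literature.NumberTheory.GaloisRepresentations.padicAlgClResidueField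 ℓ)), Summit.Langlands.Langlands.Theorems.CoreAdequacy.LieDefect.AboveCore τ.range J ∧ J ≤ τ.range ∧ Literature.NumberTheory.GaloisRepresentations.IsAbsIrreducible J.subtype ∧ (∀ f : Additive J →+ Literature.NumberTheory.GaloisRepresentations.padicAlgClResidueField ℓ, f = 0) ∧ groupCohomology.cocycles₁ (Rep.of (Literature.NumberTheory.GaloisRepresentations.Subgroup.adRep J)) ≤ groupCohomology.coboundaries₁ (Rep.of (Literature.NumberTheory.GaloisRepresentations.Subgroup.adRep J)) ∧ Literature.NumberTheory.GaloisRepresentations.Subgroup.semisimpleSpan J = ⊤) → ¬ Summit.Langlands.Langlands.Theorems.BrightMate.SolvablyReducible ρ → ¬ Summit.Langlands.Langlands.Theorems.BrightMate.SolvablyMated ι ρ → Summit.Langlands.Langlands.Theorems.CoreAdequacy.LiftTail K n hcpt ℓ ι ρ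


/-- LDF one-liner (route item `LinearDefectLifting`, declared residual). -/
def LinearDefectLifting : Prop :=
    ∀ (K : Type) [Field K] [NumberField K] (n : ℕ) (hcpt : Literature.NumberTheory.Automorphic.isCompact_glFiniteIntegralLevel n K), 0 < n → Summit.Langlands.Langlands.Theorems.CoreAdequacy.LiftBelow n → ∀ (ℓ : ℕ) [Fact ℓ.Prime] (ι : PadicAlgCl ℓ ≃+* ℂ) (ρ : Literature.NumberTheory.GaloisRepresentations.FramedGaloisRep K (PadicAlgCl ℓ) n), ℓ < 2 * (n + 1) → Summit.Langlands.Langlands.Theorems.CoreAdequacy.CycIrr ρ → ¬ Summit.Langlands.Langlands.Theorems.CoreAdequacy.AdequateCyclotomicImage ρ → ¬ Summit.Langlands.Langlands.Theorems.CoreAdequacy.SolvablyAdequateImage ρ → ¬ Summit.Langlands.Langlands.Theorems.CoreAdequacy.LieDefect.SolvableDescentShadow ρ → ¬ Summit.Langlands.Langlands.Theorems.CoreAdequacy.LieDefect.SolvablyQuasiAdequateImage ρ → ℓ ≤ n → ¬ (∃ τ : Field.absoluteGaloisGroup (CyclotomicField ℓ K) →* Matrix.GeneralLinearGroup (Fin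 n) (Literature.NumberTheory.GaloisRepresentations.padicAlgClResidueField ℓ), (ρ.restrictField (CyclotomicField ℓ K)).IsReductionOf (RingHom.id (Literature.NumberTheory.GaloisRepresentations.padicAlgClResidueField ℓ)) τ ∧ Literature.NumberTheory.GaloisRepresentations.IsAbsIrreducible τ ∧ ∃ J : Subgroup (Matrix.GeneralLinearGroup (Fin n) (Literature.NumberTheory.GaloisRepresentations.padicAlgClResidueField ℓ)), Summit.Langlands.Langlands.Theorems.CoreAdequacy.LieDefect.AboveCore τ.range J ∧ J ≤ τ.range ∧ Literature.NumberTheory.GaloisRepresentations.IsAbsIrreducible J.subtype ∧ Literature.NumberTheory.GaloisRepresentations.Subgroup.IsExtendedAdequate J) → (∃ τ : Field.absoluteGaloisGroup (CyclotomicField ℓ K) →* Matrix.GeneralLinearGroup (Fin n) (Literature.NumberTheory.GaloisRepresentations.padicAlgClResidueField ℓ), (ρ.restrictField (CyclotomicField ℓ K)).IsReductionOf (RingHom.id (Literature.NumberTheory.GaloisRepresentations.padicAlgClResidueField ℓ)) τ ∧ Literature.NumberTheory.GaloisRepresentations.IsAbsIrreducible τ ∧ Literature.NumberTheory.GaloisRepresentations.IsAbsIrreducible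 (Summit.Langlands.Langlands.Theorems.CoreAdequacy.perfectCore τ.range).subtype) → ¬ (∃ (E : Type) (_ : Field E) (_ : NumberField E) (_ : Algebra K E), IsGalois K E ∧ IsSolvable (E ≃ₐ[K] E) ∧ ((∃ (σ : Literature.NumberTheory.GaloisRepresentations.FramedGaloisRep E (PadicAlgCl ℓ) 2) (χ : Literature.NumberTheory.GaloisRepresentations.FramedGaloisRep E (PadicAlgCl ℓ) 1), σ.toGaloisRep.IsIrreducible ∧ Summit.Langlands.Langlands.Theorems.CoreAdequacy.LieDefect.Geometric σ ∧ Summit.Langlands.Langlands.Theorems.CoreAdequacy.LieDefect.Geometric χ ∧ ∀ g : Field.absoluteGaloisGroup E, 2 * Literature.NumberTheory.GaloisRepresentations.FramedRep.trace (ρ.restrictField E) g = Literature.NumberTheory.GaloisRepresentations.FramedRep.trace χ g * (Literature.NumberTheory.GaloisRepresentations.FramedRep.trace σ g ^ 2 + Literature.NumberTheory.GaloisRepresentations.FramedRep.trace σ (g * g))) ∨ (∃ σ₁ σ₂ : Literature.NumberTheory.GaloisRepresentations.FramedGaloisRep E (PadicAlgCl ℓ) 2, σ₁.toGaloisRep.IsIrreducible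 ∧ σ₂.toGaloisRep.IsIrreducible ∧ Summit.Langlands.Langlands.Theorems.CoreAdequacy.LieDefect.Geometric σ₁ ∧ Summit.Langlands.Langlands.Theorems.CoreAdequacy.LieDefect.Geometric σ₂ ∧ ∀ g : Field.absoluteGaloisGroup E, Literature.NumberTheory.GaloisRepresentations.FramedRep.trace (ρ.restrictField E) g = Literature.NumberTheory.GaloisRepresentations.FramedRep.trace σ₁ g * Literature.NumberTheory.GaloisRepresentations.FramedRep.trace σ₂ g))) → ¬ (∃ τ : Field.absoluteGaloisGroup (CyclotomicField ℓ K) →* Matrix.GeneralLinearGroup (Fin n) (Literature.NumberTheory.GaloisRepresentations.padicAlgClResidueField ℓ), (ρ.restrictField (CyclotomicField ℓ K)).IsReductionOf (RingHom.id (Literature.NumberTheory.GaloisRepresentations.padicAlgClResidueField ℓ)) τ ∧ Literature.NumberTheory.GaloisRepresentations.IsAbsIrreducible τ ∧ ∃ J : Subgroup (Matrix.GeneralLinearGroup (Fin n) (Literature.NumberTheory.GaloisRepresentations.padicAlgClResidueField ℓ)), Summit.Langlands.Langlands.Theorems.CoreAdequacy.LieDefect.AboveCore τ.range J ∧ J ≤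 τ.range ∧ Literature.NumberTheory.GaloisRepresentations.IsAbsIrreducible J.subtype ∧ (∀ f : Additive J →+ Literature.NumberTheory.GaloisRepresentations.padicAlgClResidueField ℓ, f = 0) ∧ groupCohomology.cocycles₁ (Rep.of (Literature.NumberTheory.GaloisRepresentations.Subgroup.adRep J)) ≤ groupCohomology.coboundaries₁ (Rep.of (Literature.NumberTheory.GaloisRepresentations.Subgroup.adRep J)) ∧ Literature.NumberTheory.GaloisRepresentations.Subgroup.semisimpleSpan J = ⊤) → ¬ Summit.Langlands.Langlands.Theorems.BrightMate.SolvablyReducible ρ → ¬ Summit.Langlands.Langlands.Theorems.BrightMate.SolvablyMated ι ρ → Summit.Langlands.Langlands.Theorems.CoreAdequacy.LiftTail K n hcpt ℓ ι ρ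


/-- LDF′ one-liner (layer-2 child of LDF). -/
def LinearDefectOffValentinerLifting : Prop :=
    ∀ (K : Type) [Field K] [NumberField K] (n : ℕ) (hcpt : Literature.NumberTheory.Automorphic.isCompact_glFiniteIntegralLevel n K), 0 < n → Summit.Langlands.Langlands.Theorems.CoreAdequacy.LiftBelow n → ∀ (ℓ : ℕ) [Fact ℓ.Prime] (ι : PadicAlgCl ℓ ≃+* ℂ) (ρ : Literature.NumberTheory.GaloisRepresentations.FramedGaloisRep K (PadicAlgCl ℓ) n), ℓ < 2 * (n + 1) → Summit.Langlands.Langlands.Theorems.CoreAdequacy.CycIrr ρ → ¬ Summit.Langlands.Langlands.Theorems.CoreAdequacy.AdequateCyclotomicImage ρ → ¬ Summit.Langlands.Langlands.Theorems.CoreAdequacy.SolvablyAdequateImage ρ → ¬ Summit.Langlands.Langlands.Theorems.CoreAdequacy.LieDefect.SolvableDescentShadow ρ → ¬ Summit.Langlands.Langlands.Theorems.CoreAdequacy.LieDefect.SolvablyQuasiAdequateImage ρ → ℓ ≤ n → ¬ (∃ τ : Field.absoluteGaloisGroup (CyclotomicField ℓ K) →* Matrix.GeneralLinearGroup (Fin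 n) (Literature.NumberTheory.GaloisRepresentations.padicAlgClResidueField ℓ), (ρ.restrictField (CyclotomicField ℓ K)).IsReductionOf (RingHom.id (Literature.NumberTheory.GaloisRepresentations.padicAlgClResidueField ℓ)) τ ∧ Literature.NumberTheory.GaloisRepresentations.IsAbsIrreducible τ ∧ ∃ J : Subgroup (Matrix.GeneralLinearGroup (Fin n) (Literature.NumberTheory.GaloisRepresentations.padicAlgClResidueField ℓ)), Summit.Langlands.Langlands.Theorems.CoreAdequacy.LieDefect.AboveCore τ.range J ∧ J ≤ τ.range ∧ Literature.NumberTheory.GaloisRepresentations.IsAbsIrreducible J.subtype ∧ Literature.NumberTheory.GaloisRepresentations.Subgroup.IsExtendedAdequate J) → (∃ τ : Field.absoluteGaloisGroup (CyclotomicField ℓ K) →* Matrix.GeneralLinearGroup (Fin n) (Literature.NumberTheory.GaloisRepresentations.padicAlgClResidueField ℓ), (ρ.restrictField (CyclotomicField ℓ K)).IsReductionOf (RingHom.id (Literature.NumberTheory.GaloisRepresentations.padicAlgClResidueField ℓ)) τ ∧ Literature.NumberTheory.GaloisRepresentations.IsAbsIrreducible τ ∧ Literature.NumberTheory.GaloisRepresentations.IsAbsIrreducible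 (Summit.Langlands.Langlands.Theorems.CoreAdequacy.perfectCore τ.range).subtype) → ¬ (∃ (E : Type) (_ : Field E) (_ : NumberField E) (_ : Algebra K E), IsGalois K E ∧ IsSolvable (E ≃ₐ[K] E) ∧ ((∃ (σ : Literature.NumberTheory.GaloisRepresentations.FramedGaloisRep E (PadicAlgCl ℓ) 2) (χ : Literature.NumberTheory.GaloisRepresentations.FramedGaloisRep E (PadicAlgCl ℓ) 1), σ.toGaloisRep.IsIrreducible ∧ Summit.Langlands.Langlands.Theorems.CoreAdequacy.LieDefect.Geometric σ ∧ Summit.Langlands.Langlands.Theorems.CoreAdequacy.LieDefect.Geometric χ ∧ ∀ g : Field.absoluteGaloisGroup E, 2 * Literature.NumberTheory.GaloisRepresentations.FramedRep.trace (ρ.restrictField E) g = Literature.NumberTheory.GaloisRepresentations.FramedRep.trace χ g * (Literature.NumberTheory.GaloisRepresentations.FramedRep.trace σ g ^ 2 + Literature.NumberTheory.GaloisRepresentations.FramedRep.trace σ (g * g))) ∨ (∃ σ₁ σ₂ : Literature.NumberTheory.GaloisRepresentations.FramedGaloisRep E (PadicAlgCl ℓ) 2, σ₁.toGaloisRep.IsIrreducible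 ∧ σ₂.toGaloisRep.IsIrreducible ∧ Summit.Langlands.Langlands.Theorems.CoreAdequacy.LieDefect.Geometric σ₁ ∧ Summit.Langlands.Langlands.Theorems.CoreAdequacy.LieDefect.Geometric σ₂ ∧ ∀ g : Field.absoluteGaloisGroup E, Literature.NumberTheory.GaloisRepresentations.FramedRep.trace (ρ.restrictField E) g = Literature.NumberTheory.GaloisRepresentations.FramedRep.trace σ₁ g * Literature.NumberTheory.GaloisRepresentations.FramedRep.trace σ₂ g))) → ¬ (∃ τ : Field.absoluteGaloisGroup (CyclotomicField ℓ K) →* Matrix.GeneralLinearGroup (Fin n) (Literature.NumberTheory.GaloisRepresentations.padicAlgClResidueField ℓ), (ρ.restrictField (CyclotomicField ℓ K)).IsReductionOf (RingHom.id (Literature.NumberTheory.GaloisRepresentations.padicAlgClResidueField ℓ)) τ ∧ Literature.NumberTheory.GaloisRepresentations.IsAbsIrreducible τ ∧ ∃ J : Subgroup (Matrix.GeneralLinearGroup (Fin n) (Literature.NumberTheory.GaloisRepresentations.padicAlgClResidueField ℓ)), Summit.Langlands.Langlands.Theorems.CoreAdequacy.LieDefect.AboveCore τ.range J ∧ J ≤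 τ.range ∧ Literature.NumberTheory.GaloisRepresentations.IsAbsIrreducible J.subtype ∧ (∀ f : Additive J →+ Literature.NumberTheory.GaloisRepresentations.padicAlgClResidueField ℓ, f = 0) ∧ groupCohomology.cocycles₁ (Rep.of (Literature.NumberTheory.GaloisRepresentations.Subgroup.adRep J)) ≤ groupCohomology.coboundaries₁ (Rep.of (Literature.NumberTheory.GaloisRepresentations.Subgroup.adRep J)) ∧ Literature.NumberTheory.GaloisRepresentations.Subgroup.semisimpleSpan J = ⊤) → ¬ (n = 3 ∧ ℓ = 3) → ¬ Summit.Langlands.Langlands.Theorems.BrightMate.SolvablyReducible ρ → ¬ Summit.Langlands.Langlands.Theorems.BrightMate.SolvablyMated ι ρ → Summit.Langlands.Langlands.Theorems.CoreAdequacy.LiftTail K n hcpt ℓ ι ρ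


/-- GHT one-liner (layer-2 support: the named fact by name). -/
def DegreePAdequacyClassification : Prop :=
  Literature.NumberTheory.GaloisRepresentations.ght2017_adequate_or_index_p_or_psl29.{0, 0}

/-- VAL one-liner (layer-2 support). -/
def ValentinerBoxLinearAdequacy : Prop :=
  Literature.NumberTheory.GaloisRepresentations.ght2017_adequate_or_index_p_or_psl29.{0, 0} → ∀ (K : Type) [Field K] [NumberField K] [Fact (Nat.Prime 3)] (ρ : Literature.NumberTheory.GaloisRepresentations.FramedGaloisRep K (PadicAlgCl 3) 3), (∃ τ : Field.absoluteGaloisGroup (CyclotomicField 3 K) →* Matrix.GeneralLinearGroup (Fin 3) (Literature.NumberTheory.GaloisRepresentations.padicAlgClResidueField 3), (ρ.restrictField (CyclotomicField 3 K)).IsReductionOf (RingHom.id (Literature.NumberTheory.GaloisRepresentations.padicAlgClResidueField 3)) τ ∧ Literature.NumberTheory.GaloisRepresentations.IsAbsIrreducible τ ∧ Literature.NumberTheory.GaloisRepresentations.IsAbsIrreducible (Summit.Langlands.Langlands.Theorems.CoreAdequacy.perfectCore τ.range).subtype) → (∃ τ : Field.absoluteGaloisGroup (CyclotomicField 3 K)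 →* Matrix.GeneralLinearGroup (Fin 3) (Literature.NumberTheory.GaloisRepresentations.padicAlgClResidueField 3), (ρ.restrictField (CyclotomicField 3 K)).IsReductionOf (RingHom.id (Literature.NumberTheory.GaloisRepresentations.padicAlgClResidueField 3)) τ ∧ Literature.NumberTheory.GaloisRepresentations.IsAbsIrreducible τ ∧ ∃ J : Subgroup (Matrix.GeneralLinearGroup (Fin 3) (Literature.NumberTheory.GaloisRepresentations.padicAlgClResidueField 3)), Summit.Langlands.Langlands.Theorems.CoreAdequacy.LieDefect.AboveCore τ.range J ∧ J ≤ τ.range ∧ Literature.NumberTheory.GaloisRepresentations.IsAbsIrreducible J.subtype ∧ (∀ f : Additive J →+ Literature.NumberTheory.GaloisRepresentations.padicAlgClResidueField 3, f = 0) ∧ groupCohomology.cocycles₁ (Rep.of (Literature.NumberTheory.GaloisRepresentations.Subgroup.adRep J)) ≤ groupCohomology.coboundaries₁ (Rep.of (Literature.NumberTheory.GaloisRepresentations.Subgroup.adRep J)) ∧ Literature.NumberTheory.GaloisRepresentations.Subgroup.semisimpleSpan J = ⊤)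

/-- the SCH one-liner is the structured cell (definitional). -/
theorem sch_inline_iff : SchurDefectLayerLifting ↔ ExtAdequacy.Schur.SchurDefectLayerLifting := Iff.rfl
/-- the LDF one-liner is the structured cell (definitional). -/
theorem ldf_inline_iff : LinearDefectLifting ↔ ExtAdequacy.Schur.LinearDefectLifting := Iff.rfl
/-- the LDF′ one-liner is the structured cell (definitional). -/
theorem ldfOff_inline_iff : LinearDefectOffValentinerLifting ↔ ExtAdequacy.Schur.LinearDefectOffValentinerLifting := Iff.rfl
/-- the GHT one-liner is the structured named-fact alias (definitional). -/
theorem ght_inline_iff : DegreePAdequacyClassification ↔ ExtAdequacy.Schur.DegreePAdequacyClassification := Iff.rfl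
/-- the VAL one-liner is the structured support (definitional). -/
theorem val_inline_iff : ValentinerBoxLinearAdequacy ↔ ExtAdequacy.Schur.ValentinerBoxLinearAdequacy := Iff.rfl

/-- The child route's deciding theorem, over the one-liners, concluding the HOST CRUX by name. -/
theorem closes (hS : SchurDefectLayerLifting) (hL : LinearDefectLifting) :
    Summit.Langlands.Langlands.Theses.ExtendedAdequacySplit.CoreIrreducibleNonProductLifting :=
  ExtAdequacy.Schur.closes (sch_inline_iff.1 hS) (ldf_inline_iff.1 hL)

/-- Layer-2 glue over the one-liners. -/
theorem ldf_of_carve (hG : DegreePAdequacyClassification) (hV : ValentinerBoxLinearAdequacy) (hL : LinearDefectOffValentinerLifting) : LinearDefectLifting :=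
  ldf_inline_iff.2 (ExtAdequacy.Schur.ldf_of_carve (ght_inline_iff.1 hG) (val_inline_iff.1 hV) (ldfOff_inline_iff.1 hL))

end Summit.Langlands.Langlands.Theorems.SchurDefectInline
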